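import Literature.NumberTheory.IwasawaTheory.ClassicalMuInvariantOnePrimeProofs
import Literature.NumberTheory.IwasawaTheory.ClassicalMuVanishesSubextension
import Literature.NumberTheory.EllipticCurves.IwasawaCyclotomicProofs
import Mathlib.NumberTheory.NumberField.Cyclotomic.Ideal
import Mathlib.NumberTheory.NumberField.Cyclotomic.PID
import HarnessLib

set_option autoImplicit false

/-!
# `e_n = 0` up every cyclotomic `ℤ_p`-tower of every subfield of `ℚ(μ_p)` for `p` regular
# (Iwasawa 1956 at `ℚ(μ_{p^{k+1}})` + prime-to-`p` descent of the VANISHING of `e_n`; `p = 3, 5` unconditionally)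

Topic `NumberTheory/IwasawaTheory` (namespace = path).  THEOREM-ONLY file (no definition, no named fact, no
instance, no `sorry`), written by the prover seat `bsd-potss-rkm` g35 (cell `bsd-potss`; `--supports`
stmt-BirchSwinnertonDyer-19196, crux M `ReducibleKatoMember` of the routes K9 / K8-t′; closes nothing).

WHY.  After g34 the kernel trust base of crux M on every reducible row is {modularity, Kato's two
Euler-system facts, Ferrero–Washington}; Ferrero–Washington enters at exactly one place — `ClassicalMuVanishes`
(growth form of Iwasawa's `μ = 0`) for the cyclotomic `ℤ_p`-tower of the Borel field `ℚ(χ₁, χ₂)` of the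
stable line (`Theorems/KatoDescentPotSupersingularReducibleFineSelmerMuZeroCharForm`, g33).  On the rows with
`ℚ(χ₁, χ₂) ⊆ ℚ(μ_p)` (the semisimplification is `ωᵃ ⊕ ω^{1-a}`; e.g. every row at `p = 3` whose isogeny
character is trivial or cyclotomic) that input is CLASSICAL AND ELEMENTARY: Greenberg, *Iwasawa theory — past
and present*, p. 342: «if `p` is a regular prime (i.e., a prime such that the class number of `F = ℚ(μ_p)` is
not divisible by `p`), then Proposition 2.1 immediately implies that `λ = μ = ν = 0` for this (and any)
`ℤ_p`-extension of `F`», and the vanishing descends to every subfield `K ⊆ ℚ(μ_p)` because `p ∤ [ℚ(μ_p) : K]`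
(Neukirch III (1.6) (ii): the extension of ideal classes is injective on `p`-power torsion).  Everything needed is
ALREADY a theorem of the tree or of Mathlib:

* Iwasawa 1956 / Greenberg Prop. 2.1 — the named fact
  `iwasawa1956_classNumberPExp_eq_zero_of_not_dvd_classNumber_of_unique_prime` is DISCHARGED
  (`ClassicalMuInvariantOnePrimeProofs`, Washington Thm. 10.4 at finite level);
* «exactly one prime of `ℚ(μ_{p^{k+1}})` above `p`» — Mathlib (`IsCyclotomicExtension.Rat.eq_span_zeta_sub_one_of_liesOver`,
  `p_mem_span_zeta_sub_one`: the prime `(ζ - 1)`, Washington Lemma 1.4 / Prop. 2.1);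
* `e_n(K·ℚ_∞/K) ≤ e_n(K'·ℚ_∞/K')` for `K ⊆ K'`, `p ∤ [K' : K]` — conjA-anchor g11
  (`classNumberPExp_restrict_le_of_not_dvd_finrank`, `ClassicalMuVanishesSubextension`); when the larger exponent
  is `0` NO growth theorem (`iwasawa1959_classNumberPExp_growth`) is needed to conclude, unlike the sibling
  `classicalMuVanishes_of_isCyclotomic_of_tower`;
* `h(ℚ(μ_3)) = h(ℚ(μ_5)) = 1` — Mathlib (`IsCyclotomicExtension.Rat.three_pid`, `five_pid`).

## Main results (namespace `Literature.NumberTheory.IwasawaTheory`)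

* `classNumberPExp_restrict_eq_zero_of_not_dvd_finrank`, `classNumberPExp_eq_zero_of_isCyclotomic_of_tower`,
  `classicalMuVanishes_of_isCyclotomic_of_tower_of_eq_zero` — §1, descent of `e_n = 0` along `K ⊆ K'` with
  `p ∤ [K' : F]` (growth-fact-free).
* `existsUnique_heightOneSpectrum_mem_of_isCyclotomicExtension_prime_pow` (and `…_prime`) — §2, the unique prime
  above `p` in any `p^{k+1}`-th (resp. `p`-th) cyclotomic extension of `ℚ`, in the `HeightOneSpectrum` spelling of the
  Iwasawa-1956 fact.
* `classNumberPExp_eq_zero_of_isCyclotomicExtension_prime_pow` (and `…_prime`, `classicalMuVanishes_…`) — §3,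
  `p ∤ h(K')` for a `p^{k+1}`-th cyclotomic field `K'` ⟹ `e_n(κ) = 0` for EVERY `ℤ_p`-extension `κ` of `K'` and every `n`
  (Greenberg p. 342).
* `classNumberPExp_eq_zero_of_isCyclotomic_of_algebra_cyclotomic` (instance form), `…_of_algHom` (embedding form),
  `classicalMuVanishes_of_isCyclotomic_of_algHom_cyclotomic` — §4, every number field `K` embedding in a `p`-th
  cyclotomic field `K'` with `p ∤ h(K')`: `e_n = 0` up every cyclotomic `ℤ_p`-tower of `K`.
* `classNumber_eq_one_of_isCyclotomicExtension_three/five`, `classNumberPExp_eq_zero_of_isCyclotomic_of_algHom_cyclotomic_three/five`,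
  `classicalMuVanishes_of_isCyclotomic_of_algHom_cyclotomic_three/five` — §5, `p = 3, 5` with NOTHING displayed.

HONEST SCOPE.  Classical statements, no new mathematics; the point is that on the cyclotomic-Borel rows the
`μ = 0` input of crux M's chain is a KERNEL THEOREM (consumer: `Theorems/KatoDescentPotSupersingularReducibleFineSelmerBorelCyclotomic`).
Nothing here touches `p ∣ [K' : ℚ]` (e.g. subfields of `ℚ(μ_{p²})` other than those of `ℚ(μ_p)`), irregular `p`,
or Ferrero–Washington itself.

## References

* R. Greenberg, *Iwasawa theory — past and present*, Adv. Stud. Pure Math. 30 (2001), Prop. (2.1) p. 339 and the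
  remark on regular primes p. 342 — store key `paper:doi-10-2969-aspm-03010335`, p. 342 read by this seat.
  [Greenberg2001IwasawaPastPresent]
* L. C. Washington, *Introduction to Cyclotomic Fields*, GTM 83 (1997), Lemma 1.4, Prop. 2.1, Thm. 10.4, Prop. 13.22.
  [Washington1997]
* J. Neukirch, *Algebraic Number Theory* (1999), Ch. III §1 Prop. (1.6) (ii); Ch. I §10 (the prime `(1 - ζ)`). [NeukirchANT1999]
* K. Iwasawa, Abh. Math. Sem. Univ. Hamburg 20 (1956) 257–258 (original; not held). [Iwasawa1956]
* Tree: `ClassicalMuInvariantOnePrimeProofs` (Iwasawa 1956 `_holds`), `ClassicalMuVanishesSubextension` (conjA-anchor g11),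
  `ClassicalMuVanishesNormRelationTower` (`classNumberPExp_eq_of_isCyclotomic`), `IwasawaCyclotomicProofs`
  (`ZpExtension.exists_isCyclotomic_holds`); Mathlib `NumberTheory/NumberField/Cyclotomic/{Ideal,PID,Basic}`.
-/

noncomputable section

open scoped NumberField

open NumberField IsDedekindDomain Field IntermediateField
  Literature.NumberTheory.GaloisRepresentations Literature.NumberTheory.EllipticCurves
  Literature.NumberTheory.EllipticCurves.ZpExtension Literature.NumberTheory.NumberFields

namespace Literature.NumberTheory.IwasawaTheory

/-! ### §1 Descent of the VANISHING of `e_n` to subfields of `p`-prime index (no growth theorem) -/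

section Descent

variable {F : Type} [Field F] [NumberField F] {p : ℕ} [Fact p.Prime]

/-- **`e_n(κ|_{K'}) = 0 ⟹ e_n(κ|_K) = 0` for `F ⊆ K ⊆ K'` with `p ∤ [K' : K]`** — the vanishing case of conjA-anchor's
monotonicity `classNumberPExp_restrict_le_of_not_dvd_finrank` (Neukirch III (1.6) (ii): extension of classes is injective on
`p`-power torsion when `p ∤ [K' : K]`).  No growth theorem is used. [cite: NeukirchANT1999, Ch. III §1 Prop. (1.6) (ii)]
[cite: Washington1997, §13.1] -/
theorem classNumberPExp_restrict_eq_zero_of_not_dvd_finrank (κ : ZpExtension F p) (K K' : Type) [Field K]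
    [NumberField K] [Algebra F K] [Field K'] [NumberField K'] [Algebra F K'] [Algebra K K']
    [IsScalarTower F K K'] (hpd : ¬ p ∣ Module.finrank K K')
    (hK : Function.Surjective (κ.toContinuousMonoidHom.comp (absGaloisRestrict F K)))
    (hK' : Function.Surjective (κ.toContinuousMonoidHom.comp (absGaloisRestrict F K'))) (n : ℕ)
    (h : classNumberPExp (κ.restrict K' hK') n = 0) : classNumberPExp (κ.restrict K hK) n = 0 :=
  Nat.eq_zero_of_le_zero (h ▸ classNumberPExp_restrict_le_of_not_dvd_finrank κ K K' hpd hK hK' n)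

/-- **`e_n = 0` for every cyclotomic `ℤ_p`-tower of `K'` ⟹ the same for every subfield `K ⊇ F` of `K'` with `p ∤ [K' : F]`**
(`κ` a cyclotomic `ℤ_p`-extension of the base `F`; the restricted towers are cyclotomic and all cyclotomic towers of a field have
the same layers, `classNumberPExp_eq_of_isCyclotomic`).  The vanishing twin of `classicalMuVanishes_of_isCyclotomic_of_tower`,
WITHOUT the growth fact `iwasawa1959_classNumberPExp_growth`. [cite: NeukirchANT1999, Ch. III §1 Prop. (1.6) (ii)]
[cite: Washington1997, §13.1] -/
theorem classNumberPExp_eq_zero_of_isCyclotomic_of_tower (κ : ZpExtension F p) (hκ : κ.IsCyclotomic)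
    (K K' : Type) [Field K] [NumberField K] [Algebra F K] [Field K'] [NumberField K'] [Algebra F K']
    [Algebra K K'] [IsScalarTower F K K'] (hp : ¬ p ∣ Module.finrank F K')
    (hzero : ∀ κ' : ZpExtension K' p, κ'.IsCyclotomic → ∀ n, classNumberPExp κ' n = 0)
    (κK : ZpExtension K p) (hκK : κK.IsCyclotomic) (n : ℕ) : classNumberPExp κK n = 0 := by
  haveI : FiniteDimensional F K := Module.Finite.of_restrictScalars_finite ℚ F K
  haveI : FiniteDimensional F K' := Module.Finite.of_restrictScalars_finite ℚ F K'
  haveI : FiniteDimensional K K' := Module.Finite.of_restrictScalars_finite F K K'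
  have hKK' := Module.finrank_mul_finrank F K K'
  have hpK : ¬ p ∣ Module.finrank F K := fun h => hp (hKK' ▸ dvd_mul_of_dvd_left h _)
  have hpd : ¬ p ∣ Module.finrank K K' := fun h => hp (hKK' ▸ dvd_mul_of_dvd_right h _)
  have hK := surjective_comp_absGaloisRestrict_of_not_dvd_finrank κ K hpK
  have hK' := surjective_comp_absGaloisRestrict_of_not_dvd_finrank κ K' hp
  have h1 : classNumberPExp (κ.restrict K hK) n = 0 :=
    classNumberPExp_restrict_eq_zero_of_not_dvd_finrank κ K K' hpd hK hK' n
      (hzero _ (isCyclotomic_restrict κ hκ K' hK') n)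
  rw [classNumberPExp_eq_of_isCyclotomic κK (κ.restrict K hK) hκK (isCyclotomic_restrict κ hκ K hK) n]
  exact h1

/-- Growth-form corollary: under the hypotheses of `classNumberPExp_eq_zero_of_isCyclotomic_of_tower`, every cyclotomic
`ℤ_p`-extension of `K` satisfies `ClassicalMuVanishes` (indeed `λ = ν = 0`, `n₀ = 0`). [cite: NeukirchANT1999, Ch. III §1 Prop. (1.6) (ii)]
[cite: Lang1990, Ch. 5 §4 Thm. 4.3 (pp. 137–143)] -/
theorem classicalMuVanishes_of_isCyclotomic_of_tower_of_eq_zero (κ : ZpExtension F p) (hκ : κ.IsCyclotomic)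
    (K K' : Type) [Field K] [NumberField K] [Algebra F K] [Field K'] [NumberField K'] [Algebra F K']
    [Algebra K K'] [IsScalarTower F K K'] (hp : ¬ p ∣ Module.finrank F K')
    (hzero : ∀ κ' : ZpExtension K' p, κ'.IsCyclotomic → ∀ n, classNumberPExp κ' n = 0)
    (κK : ZpExtension K p) (hκK : κK.IsCyclotomic) : ClassicalMuVanishes κK :=
  classicalMuVanishes_of_eventually_const κK (c := 0) (n₀ := 0) fun n _ =>
    classNumberPExp_eq_zero_of_isCyclotomic_of_tower κ hκ K K' hp hzero κK hκK n

end Descent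

/-! ### §2 Exactly one prime above `p` in `ℚ(μ_{p^{k+1}})` (Mathlib's `(ζ - 1)`), in the spelling of the Iwasawa-1956 fact -/

/-- **`ℚ(μ_{p^{k+1}})` has exactly one prime above `p`** (the prime `(ζ - 1)`, totally ramified of residue degree `1`):
`∃! v : HeightOneSpectrum (𝓞 K'), p ∈ v`.  Mathlib: `IsCyclotomicExtension.Rat.p_mem_span_zeta_sub_one` (existence) and
`eq_span_zeta_sub_one_of_liesOver` (uniqueness; a maximal ideal containing `p` lies over `(p) ⊂ ℤ`).
[cite: Washington1997, Lemma 1.4 and Prop. 2.1] [cite: NeukirchANT1999, Ch. I §10 (Lemma 10.1)] -/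
theorem existsUnique_heightOneSpectrum_mem_of_isCyclotomicExtension_prime_pow (p k : ℕ) [hp : Fact p.Prime]
    (K' : Type*) [Field K'] [NumberField K'] [hK : IsCyclotomicExtension {p ^ (k + 1)} ℚ K'] :
    ∃! v : HeightOneSpectrum (𝓞 K'), ((p : ℕ) : 𝓞 K') ∈ v.asIdeal := by
  have hζ := IsCyclotomicExtension.zeta_spec (p ^ (k + 1)) ℚ K'
  haveI := IsCyclotomicExtension.Rat.isPrime_span_zeta_sub_one p k hζ
  let v₀ : HeightOneSpectrum (𝓞 K') :=
    ⟨Ideal.span {hζ.toInteger - 1}, inferInstance, IsCyclotomicExtension.Rat.span_zeta_sub_one_ne_bot p k hζ⟩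
  refine ⟨v₀, IsCyclotomicExtension.Rat.p_mem_span_zeta_sub_one p k hζ, fun v hv => ?_⟩
  haveI : v.asIdeal.IsPrime := v.isPrime
  haveI : v.asIdeal.LiesOver (Ideal.span {(p : ℤ)}) := by
    rw [Ideal.liesOver_iff]
    refine Ideal.IsMaximal.eq_of_le (Int.ideal_span_isMaximal_of_prime p) Ideal.IsPrime.ne_top' ?_
    rw [Ideal.span_singleton_le_iff_mem, Ideal.mem_comap, algebraMap_int_eq, map_natCast]
    exact hv
  exact HeightOneSpectrum.ext (IsCyclotomicExtension.Rat.eq_span_zeta_sub_one_of_liesOver p k K' hζ v.asIdeal)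

/-- **`ℚ(μ_p)` has exactly one prime above `p`** (`k = 0` of the previous statement).
[cite: Washington1997, Lemma 1.4] [cite: NeukirchANT1999, Ch. I §10 (Lemma 10.1)] -/
theorem existsUnique_heightOneSpectrum_mem_of_isCyclotomicExtension_prime (p : ℕ) [Fact p.Prime]
    (K' : Type*) [Field K'] [NumberField K'] [hK : IsCyclotomicExtension {p} ℚ K'] :
    ∃! v : HeightOneSpectrum (𝓞 K'), ((p : ℕ) : 𝓞 K') ∈ v.asIdeal := by
  rw [← pow_one p] at hK
  exact existsUnique_heightOneSpectrum_mem_of_isCyclotomicExtension_prime_pow p 0 K'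

/-! ### §3 Iwasawa 1956 at a cyclotomic field with `p ∤ h`: `e_n = 0` for EVERY `ℤ_p`-extension (Greenberg p. 342) -/

/-- **`p ∤ h(ℚ(μ_{p^{k+1}}))` ⟹ `e_n(κ) = 0` for every `ℤ_p`-extension `κ` of `ℚ(μ_{p^{k+1}})` and every `n`** (Greenberg 2001
p. 342: for `p` regular «Proposition 2.1 immediately implies that `λ = μ = ν = 0` for this (and any) `ℤ_p`-extension of `F`»):
the DISCHARGED Iwasawa-1956 fact at the cyclotomic field, whose second hypothesis (one prime above `p`) is §2.  Stated for any
field `K'` with `IsCyclotomicExtension {p^(k+1)} ℚ K'`. [cite: Greenberg2001IwasawaPastPresent, Prop. 2.1 p. 339 and p. 342]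
[cite: Washington1997, Thm. 10.4 and Prop. 13.22] -/
theorem classNumberPExp_eq_zero_of_isCyclotomicExtension_prime_pow (p k : ℕ) [Fact p.Prime]
    (K' : Type) [Field K'] [NumberField K'] [IsCyclotomicExtension {p ^ (k + 1)} ℚ K']
    (hreg : ¬ p ∣ NumberField.classNumber K') (κ : ZpExtension K' p) (n : ℕ) : classNumberPExp κ n = 0 :=
  iwasawa1956_classNumberPExp_eq_zero_of_not_dvd_classNumber_of_unique_prime_holds K' p hreg
    (existsUnique_heightOneSpectrum_mem_of_isCyclotomicExtension_prime_pow p k K') κ n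

/-- **`p ∤ h(ℚ(μ_p))` (`p` regular) ⟹ `e_n(κ) = 0` for every `ℤ_p`-extension `κ` of `ℚ(μ_p)` and every `n`** — in particular
`p ∤ h(ℚ(μ_{p^{n+1}}))` for all `n` along the cyclotomic tower. [cite: Greenberg2001IwasawaPastPresent, p. 342]
[cite: Washington1997, Prop. 13.22] -/
theorem classNumberPExp_eq_zero_of_isCyclotomicExtension_prime (p : ℕ) [Fact p.Prime]
    (K' : Type) [Field K'] [NumberField K'] [hK : IsCyclotomicExtension {p} ℚ K']
    (hreg : ¬ p ∣ NumberField.classNumber K') (κ : ZpExtension K' p) (n : ℕ) : classNumberPExp κ n = 0 :=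
  iwasawa1956_classNumberPExp_eq_zero_of_not_dvd_classNumber_of_unique_prime_holds K' p hreg
    (existsUnique_heightOneSpectrum_mem_of_isCyclotomicExtension_prime p K') κ n

/-- Growth form: for `p ∤ h(ℚ(μ_p))` every `ℤ_p`-extension of `ℚ(μ_p)` has `ClassicalMuVanishes` (`λ = μ = ν = 0`).
[cite: Greenberg2001IwasawaPastPresent, Prop. 2.1 p. 339 and p. 342] -/
theorem classicalMuVanishes_of_isCyclotomicExtension_prime (p : ℕ) [Fact p.Prime]
    (K' : Type) [Field K'] [NumberField K'] [IsCyclotomicExtension {p} ℚ K']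
    (hreg : ¬ p ∣ NumberField.classNumber K') (κ : ZpExtension K' p) : ClassicalMuVanishes κ :=
  classicalMuVanishes_of_eventually_const κ (c := 0) (n₀ := 0) fun n _ =>
    classNumberPExp_eq_zero_of_isCyclotomicExtension_prime p K' hreg κ n

/-! ### §4 Subfields of `ℚ(μ_p)`: `e_n = 0` up every cyclotomic `ℤ_p`-tower when `p ∤ h(ℚ(μ_p))` -/

/-- `p ∤ [K' : ℚ] = p - 1` for a `p`-th cyclotomic extension `K'` of `ℚ`. [cite: Washington1997, Thm. 2.5 (degree of ℚ(ζ_n))] -/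
theorem not_dvd_finrank_of_isCyclotomicExtension_prime (p : ℕ) [hp : Fact p.Prime]
    (K' : Type*) [Field K'] [NumberField K'] [IsCyclotomicExtension {p} ℚ K'] :
    ¬ p ∣ Module.finrank ℚ K' := by
  haveI : NeZero p := ⟨hp.out.ne_zero⟩
  rw [IsCyclotomicExtension.Rat.finrank p K', Nat.totient_prime hp.out]
  intro h
  have h1 : p - 1 < p := Nat.sub_lt hp.out.pos Nat.one_pos
  have h2 : 0 < p - 1 := Nat.sub_pos_of_lt hp.out.one_lt
  exact absurd (Nat.le_of_dvd h2 h) (not_le.mpr h1)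

/-- **Every number field `K` inside a `p`-th cyclotomic field `K'` with `p ∤ h(K')` has `e_n = 0` up every cyclotomic
`ℤ_p`-tower** (instance form: `K'` a `K`-algebra compatible with `ℚ`): Iwasawa 1956 at `K'` (§3) descended along `K ⊆ K'`,
`p ∤ [K' : ℚ] = p - 1` (§1).  [cite: Greenberg2001IwasawaPastPresent, Prop. 2.1 p. 339 and p. 342]
[cite: NeukirchANT1999, Ch. III §1 Prop. (1.6) (ii)] -/
theorem classNumberPExp_eq_zero_of_isCyclotomic_of_algebra_cyclotomic (p : ℕ) [Fact p.Prime]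
    (K K' : Type) [Field K] [NumberField K] [Field K'] [NumberField K'] [Algebra K K'] [IsScalarTower ℚ K K']
    [IsCyclotomicExtension {p} ℚ K'] (hreg : ¬ p ∣ NumberField.classNumber K')
    (κK : ZpExtension K p) (hκK : κK.IsCyclotomic) (n : ℕ) : classNumberPExp κK n = 0 := by
  obtain ⟨κ, hκ⟩ := ZpExtension.exists_isCyclotomic_holds ℚ p (GaloisRep.cyclotomicCharacter_range_infinite ℚ p)
  exact classNumberPExp_eq_zero_of_isCyclotomic_of_tower κ hκ K K'
    (not_dvd_finrank_of_isCyclotomicExtension_prime p K')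
    (fun κ' _ m => classNumberPExp_eq_zero_of_isCyclotomicExtension_prime p K' hreg κ' m) κK hκK n

/-- **Embedding form**: a number field `K` with a `ℚ`-algebra map into a `p`-th cyclotomic field `K'` with `p ∤ h(K')` has
`e_n = 0` up every cyclotomic `ℤ_p`-tower. [cite: Greenberg2001IwasawaPastPresent, Prop. 2.1 p. 339 and p. 342]
[cite: NeukirchANT1999, Ch. III §1 Prop. (1.6) (ii)] -/
theorem classNumberPExp_eq_zero_of_isCyclotomic_of_algHom_cyclotomic (p : ℕ) [Fact p.Prime]
    (K K' : Type) [Field K] [NumberField K] [Field K'] [NumberField K'] [IsCyclotomicExtension {p} ℚ K']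
    (f : K →ₐ[ℚ] K') (hreg : ¬ p ∣ NumberField.classNumber K')
    (κK : ZpExtension K p) (hκK : κK.IsCyclotomic) (n : ℕ) : classNumberPExp κK n = 0 := by
  letI : Algebra K K' := f.toRingHom.toAlgebra
  haveI : IsScalarTower ℚ K K' := IsScalarTower.of_algebraMap_eq fun x => (f.commutes x).symm
  exact classNumberPExp_eq_zero_of_isCyclotomic_of_algebra_cyclotomic p K K' hreg κK hκK n

/-- Growth form of the embedding statement: `ClassicalMuVanishes` for every cyclotomic `ℤ_p`-extension of a number field
embedding in a `p`-th cyclotomic field `K'` with `p ∤ h(K')`. [cite: Greenberg2001IwasawaPastPresent, p. 342]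
[cite: NeukirchANT1999, Ch. III §1 Prop. (1.6) (ii)] -/
theorem classicalMuVanishes_of_isCyclotomic_of_algHom_cyclotomic (p : ℕ) [Fact p.Prime]
    (K K' : Type) [Field K] [NumberField K] [Field K'] [NumberField K'] [IsCyclotomicExtension {p} ℚ K']
    (f : K →ₐ[ℚ] K') (hreg : ¬ p ∣ NumberField.classNumber K')
    (κK : ZpExtension K p) (hκK : κK.IsCyclotomic) : ClassicalMuVanishes κK :=
  classicalMuVanishes_of_eventually_const κK (c := 0) (n₀ := 0) fun n _ =>
    classNumberPExp_eq_zero_of_isCyclotomic_of_algHom_cyclotomic p K K' f hreg κK hκK n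

/-! ### §5 `p = 3` and `p = 5`: nothing displayed (`h(ℚ(μ_3)) = h(ℚ(μ_5)) = 1`, Mathlib) -/

/-- `h(K') = 1` for every third cyclotomic extension `K'` of `ℚ` (Mathlib: `𝓞 K'` is a PID). [cite: Washington1997, §11.5 table (h(ℚ(ζ_n)) = 1 for small n)] -/
theorem classNumber_eq_one_of_isCyclotomicExtension_three (K' : Type*) [Field K'] [NumberField K']
    [IsCyclotomicExtension {3} ℚ K'] : NumberField.classNumber K' = 1 :=
  NumberField.classNumber_eq_one_iff.mpr (IsCyclotomicExtension.Rat.three_pid K')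

/-- `h(K') = 1` for every fifth cyclotomic extension `K'` of `ℚ` (Mathlib: `𝓞 K'` is a PID). [cite: Washington1997, §11.5 table (h(ℚ(ζ_n)) = 1 for small n)] -/
theorem classNumber_eq_one_of_isCyclotomicExtension_five (K' : Type*) [Field K'] [NumberField K']
    [IsCyclotomicExtension {5} ℚ K'] : NumberField.classNumber K' = 1 :=
  NumberField.classNumber_eq_one_iff.mpr (IsCyclotomicExtension.Rat.five_pid K')

/-- **`p = 3`, fact-free**: every number field `K` embedding in a third cyclotomic field (so `K ≅ ℚ` or `K ≅ ℚ(√-3)`) has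
`e_n = 0` up every cyclotomic `ℤ_3`-tower — in particular `3 ∤ h(ℚ(μ_{3^{n+1}}))` for all `n`.
[cite: Greenberg2001IwasawaPastPresent, Prop. 2.1 p. 339 and p. 342] -/
theorem classNumberPExp_eq_zero_of_isCyclotomic_of_algHom_cyclotomic_three [Fact (3 : ℕ).Prime]
    (K K' : Type) [Field K] [NumberField K] [Field K'] [NumberField K'] [IsCyclotomicExtension {3} ℚ K']
    (f : K →ₐ[ℚ] K') (κK : ZpExtension K 3) (hκK : κK.IsCyclotomic) (n : ℕ) : classNumberPExp κK n = 0 :=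
  classNumberPExp_eq_zero_of_isCyclotomic_of_algHom_cyclotomic 3 K K' f
    (by rw [classNumber_eq_one_of_isCyclotomicExtension_three K']; decide) κK hκK n

/-- **`p = 3`, growth form, fact-free**: `ClassicalMuVanishes` for every cyclotomic `ℤ_3`-extension of a number field
embedding in a third cyclotomic field. [cite: Greenberg2001IwasawaPastPresent, p. 342] -/
theorem classicalMuVanishes_of_isCyclotomic_of_algHom_cyclotomic_three [Fact (3 : ℕ).Prime]
    (K K' : Type) [Field K] [NumberField K] [Field K'] [NumberField K'] [IsCyclotomicExtension {3} ℚ K']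
    (f : K →ₐ[ℚ] K') (κK : ZpExtension K 3) (hκK : κK.IsCyclotomic) : ClassicalMuVanishes κK :=
  classicalMuVanishes_of_isCyclotomic_of_algHom_cyclotomic 3 K K' f
    (by rw [classNumber_eq_one_of_isCyclotomicExtension_three K']; decide) κK hκK

/-- **`p = 5`, fact-free**: every number field `K` embedding in a fifth cyclotomic field has `e_n = 0` up every cyclotomic
`ℤ_5`-tower. [cite: Greenberg2001IwasawaPastPresent, Prop. 2.1 p. 339 and p. 342] -/
theorem classNumberPExp_eq_zero_of_isCyclotomic_of_algHom_cyclotomic_five [Fact (5 : ℕ).Prime]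
    (K K' : Type) [Field K] [NumberField K] [Field K'] [NumberField K'] [IsCyclotomicExtension {5} ℚ K']
    (f : K →ₐ[ℚ] K') (κK : ZpExtension K 5) (hκK : κK.IsCyclotomic) (n : ℕ) : classNumberPExp κK n = 0 :=
  classNumberPExp_eq_zero_of_isCyclotomic_of_algHom_cyclotomic 5 K K' f
    (by rw [classNumber_eq_one_of_isCyclotomicExtension_five K']; decide) κK hκK n

/-- **`p = 5`, growth form, fact-free**: `ClassicalMuVanishes` for every cyclotomic `ℤ_5`-extension of a number field
embedding in a fifth cyclotomic field. [cite: Greenberg2001IwasawaPastPresent, p. 342] -/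
theorem classicalMuVanishes_of_isCyclotomic_of_algHom_cyclotomic_five [Fact (5 : ℕ).Prime]
    (K K' : Type) [Field K] [NumberField K] [Field K'] [NumberField K'] [IsCyclotomicExtension {5} ℚ K']
    (f : K →ₐ[ℚ] K') (κK : ZpExtension K 5) (hκK : κK.IsCyclotomic) : ClassicalMuVanishes κK :=
  classicalMuVanishes_of_isCyclotomic_of_algHom_cyclotomic 5 K K' f
    (by rw [classNumber_eq_one_of_isCyclotomicExtension_five K']; decide) κK hκK

end Literature.NumberTheory.IwasawaTheory

end
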